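import Literature.MathematicalPhysics.QuantumFieldTheory.YangMillsOS
import Literature.MathematicalPhysics.QuantumFieldTheory.LatticeMassGap
import Literature.MathematicalPhysics.QuantumFieldTheory.LatticeMassGapProofs
import Literature.MathematicalPhysics.QuantumFieldTheory.LatticeGaugeProofs
import Literature.MathematicalPhysics.QuantumFieldTheory.ConstructiveQFTWave0OddRPProofs
import Literature.Probability.LatticeModels.OSReconstruction
import Literature.MathematicalPhysics.QuantumLattice.LatticeGaugeDLR
import Literature.MathematicalPhysics.QuantumFieldTheory.GaugeOSData
import HarnessLib

/-!
# Stub `stub_cylinderApprox` of crux `ClusteringToYangMills` (stmt-QuantumFields-9443)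

Line `spectral-requantisation-dock`.

Two measure-theoretic side conditions of the Osterwalder–Seiler re-quantisation of lattice gauge
fields over a compact simple Lie group `G` (Glimm–Jaffe 1987 §6.1; Osterwalder–Seiler 1978 §2),
on the configuration space `LGConfig 4 G = (ZdEdge 4 → G)` with its product topology and product
σ-algebra:

* `CylinderApprox μ` for EVERY finite measure `μ`: a bounded observable measurable for the
  positive-time σ-algebra `𝓔₊ = cylinderEvents posTimeEdges` is the `L²(μ)`-limit of bounded
  continuous cylinder observables supported on finitely many positive-time links (and again
  `𝓔₊`-measurable);
* `CylinderExt G`: two probability measures with the same integrals of bounded continuous real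
  cylinder observables are equal.

## Proof design

Everything rests on the **coordinate truncations** `s.mulIndicator U = (U on s, 1 off s)`
(Mathlib `Set.mulIndicator`):

* an `𝓔₊`-measurable `F` depends only on the positive-time links (Mathlib
  `Measurable.factorsThrough`), so `F = F ∘ P` for the truncation `P` to `posTimeEdges`;
* `G` is second countable (closed embedding by the faithful representation of
  `IsCompactSimpleLieGroup`) and regular (topological group), so the countable product
  `LGConfig 4 G` is second countable, regular, hence pseudo-metrisable (Urysohn) and Borel
  (`Pi.borelSpace`); finite Borel measures on it are weakly regular, and Mathlib's
  `MemLp.exists_boundedContinuous_eLpNorm_sub_le` gives a bounded continuous `g` close to `F`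
  in `L²(P_* μ)`; pulling back along `P` gives `g ∘ P` close to `F = F ∘ P` in `L²(μ)`;
* along an exhausting sequence of finite sets `Λₙ ↑ Δ` (countable index type) the truncations
  converge in the product topology, so `g ∘ P_{Λₙ} → g ∘ P_Δ` boundedly and pointwise; dominated
  convergence finishes `CylinderApprox`, and (with `Δ = univ`, `P_univ = id`) shows that the
  integrals of the continuous cylinder observables `f ∘ P_{Λₙ}` converge to `∫ f`, which with
  Mathlib's `ext_of_forall_integral_eq_of_IsFiniteMeasure` gives `CylinderExt`.

The helper lemmas (`tendsto_integral_mulIndicator`, `exists_finset_seq_exhaust`,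
`dependsOn_of_measurable_cylinderEvents'`, `cylinderApprox_of_secondCountable`,
`cylinderExt_of_secondCountable`) are stated for general index types / second countable groups
and are reusable by the other stubs of the line.

## References

* J. Glimm, A. Jaffe, *Quantum Physics. A Functional Integral Point of View*, 2nd ed.,
  Springer 1987, §6.1 (positive-time algebra, local approximation of observables).
* K. Osterwalder, E. Seiler, *Gauge field theories on a lattice*, Ann. Phys. 110 (1978) 440–471,
  §2.
-/

noncomputable section

open scoped BigOperators Topology ENNReal InnerProductSpace ComplexConjugate
open MeasureTheory Filter
open Literature.MathematicalPhysics.QuantumFieldTheory Literature.MathematicalPhysics.QuantumLattice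
open Literature.Probability.LatticeModels (IsOSReconstructible IsBoundedMeasurable positiveEvents
  TransferData)

namespace Summit.QuantumFields.YangMills.Theorems.ClusteringToYangMills

open TopologicalSpace BoundedContinuousFunction Set

/-! ### Cylinder measurability and exhaustions -/

section General

variable {ι : Type*}

-- adapted from Literature/Probability/LatticeModels/ReflectionPositivityExtension.lean
-- (`dependsOn_of_measurable_cylinderEvents`, real-valued there; arbitrary codomain here)
/-- A function measurable for the cylinder σ-algebra of `Δ` depends only on the coordinates in
`Δ` (it factors through the restriction to `Δ`; Mathlib `Measurable.factorsThrough`). [folklore] -/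
theorem dependsOn_of_measurable_cylinderEvents' {G : Type*} [MeasurableSpace G] {β : Type*}
    [MeasurableSpace β] [MeasurableSingletonClass β] {Δ : Set ι} {F : (ι → G) → β}
    (hF : Measurable[cylinderEvents (X := fun _ : ι => G) Δ] F) : DependsOn F Δ := by
  have hle : cylinderEvents (X := fun _ : ι => G) Δ ≤
      MeasurableSpace.comap (Set.restrict Δ) MeasurableSpace.pi := by
    refine iSup₂_le fun i hi => ?_
    have : (fun σ : ι → G => σ i) = (fun η : Δ → G => η ⟨i, hi⟩) ∘ Set.restrict Δ := rfl
    rw [this, ← MeasurableSpace.comap_comp]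
    exact MeasurableSpace.comap_mono (measurable_pi_apply _).comap_le
  exact dependsOn_iff_factorsThrough.2 (hF.mono hle le_rfl).factorsThrough

/-- **Exhaustion of an index set by finite subsets** (countable index type): a sequence of finite
subsets of `Δ` such that every element of `Δ` eventually belongs to all of them. [folklore] -/
theorem exists_finset_seq_exhaust [Countable ι] (Δ : Set ι) :
    ∃ Λ : ℕ → Finset ι, (∀ n, (↑(Λ n) : Set ι) ⊆ Δ) ∧ ∀ e ∈ Δ, ∀ᶠ n in atTop, e ∈ Λ n := by
  classical
  rcases isEmpty_or_nonempty ι with hι | hι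
  · exact ⟨fun _ => ∅, fun n => by simp, fun e => isEmptyElim e⟩
  · obtain ⟨f, hf⟩ := exists_surjective_nat ι
    refine ⟨fun n => ((Finset.range (n + 1)).image f).filter (· ∈ Δ), fun n e he => ?_,
      fun e he => ?_⟩
    · simp only [Finset.coe_filter, Set.mem_setOf_eq] at he
      exact he.2
    · obtain ⟨k, rfl⟩ := hf e
      refine eventually_atTop.2 ⟨k, fun n hn => ?_⟩
      simp only [Finset.mem_filter, Finset.mem_image, Finset.mem_range]
      exact ⟨⟨k, by omega, rfl⟩, he⟩

end General

/-! ### Coordinate truncations of configurations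

The truncation of a configuration `U : ι → G` to the index set `s` keeps the coordinates in `s`
and resets all others to `1`; this is Mathlib's `Set.mulIndicator s U`.  Functions of
`s.mulIndicator U` are exactly the observables depending only on the coordinates in `s`, and
along an exhausting sequence of finite sets the truncations converge in the product topology. -/

section Truncation

variable {ι : Type*} {G : Type*} [One G]

/-- Any function of the truncation to `s` depends only on the coordinates in `s`. [folklore] -/
theorem dependsOn_comp_mulIndicator {β : Type*} (g : (ι → G) → β) (s : Set ι) :
    DependsOn (fun U => g (s.mulIndicator U)) s :=
  fun _ _ h => congrArg g (Set.mulIndicator_congr fun e he => h e he)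

/-- A function depending only on the coordinates in `s` does not see the truncation to `s`.
[folklore] -/
theorem apply_mulIndicator_of_dependsOn {β : Type*} {F : (ι → G) → β} {s : Set ι}
    (h : DependsOn F s) (U : ι → G) : F (s.mulIndicator U) = F U :=
  h fun _ he => Set.mulIndicator_of_mem he U

/-- Truncation is continuous for the product topology. [folklore] -/
theorem continuous_config_mulIndicator [TopologicalSpace G] (s : Set ι) :
    Continuous (s.mulIndicator : (ι → G) → ι → G) :=
  continuous_pi fun e => by
    by_cases he : e ∈ s
    · simp only [Set.mulIndicator_of_mem he]
      exact continuous_apply e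
    · simp only [Set.mulIndicator_of_notMem he]
      exact continuous_const

/-- Truncation to `s ⊆ Δ` is measurable from the cylinder σ-algebra of `Δ` to the full product
σ-algebra. [folklore] -/
theorem measurable_config_mulIndicator [MeasurableSpace G] {s Δ : Set ι} (h : s ⊆ Δ) :
    Measurable[cylinderEvents (X := fun _ : ι => G) Δ, MeasurableSpace.pi]
      (s.mulIndicator : (ι → G) → ι → G) := by
  rw [← cylinderEvents_univ, measurable_cylinderEvents_iff]
  intro e _
  by_cases he : e ∈ s
  · simp only [Set.mulIndicator_of_mem he]
    exact measurable_cylinderEvent_apply (h he)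
  · simp only [Set.mulIndicator_of_notMem he]
    exact measurable_const

/-- Along an exhausting sequence of finite subsets of `Δ` the truncations converge, in the
product topology, to the truncation to `Δ`. [folklore] -/
theorem tendsto_config_mulIndicator [TopologicalSpace G] {Δ : Set ι} {Λ : ℕ → Finset ι}
    (hΛ : ∀ n, (↑(Λ n) : Set ι) ⊆ Δ) (hev : ∀ e ∈ Δ, ∀ᶠ n in atTop, e ∈ Λ n) (U : ι → G) :
    Tendsto (fun n => (↑(Λ n) : Set ι).mulIndicator U) atTop (𝓝 (Δ.mulIndicator U)) := by
  refine tendsto_pi_nhds.2 fun e => ?_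
  by_cases he : e ∈ Δ
  · rw [Set.mulIndicator_of_mem he]
    refine (tendsto_const_nhds (x := U e)).congr' ?_
    filter_upwards [hev e he] with n hn
    exact (Set.mulIndicator_of_mem (Finset.mem_coe.2 hn) U).symm
  · rw [Set.mulIndicator_of_notMem he]
    exact tendsto_const_nhds.congr fun n =>
      (Set.mulIndicator_of_notMem (fun h => he (hΛ n h)) U).symm

/-- **Dominated convergence along truncations**: for a bounded jointly continuous integrand
`h U V` and a finite measure, `∫ h U (Λₙ.mulIndicator U) dμ → ∫ h U (Δ.mulIndicator U) dμ`
along an exhausting sequence `Λₙ ↑ Δ` (Glimm–Jaffe 1987 §6.1: local observables approximate).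
[folklore] -/
theorem tendsto_integral_mulIndicator [Countable ι] [TopologicalSpace G] [MeasurableSpace G]
    [SecondCountableTopology G] [OpensMeasurableSpace G]
    {E : Type*} [NormedAddCommGroup E] [NormedSpace ℝ E]
    {Δ : Set ι} {Λ : ℕ → Finset ι} (hΛ : ∀ n, (↑(Λ n) : Set ι) ⊆ Δ)
    (hev : ∀ e ∈ Δ, ∀ᶠ n in atTop, e ∈ Λ n) (μ : Measure (ι → G)) [IsFiniteMeasure μ]
    {h : (ι → G) → (ι → G) → E} (hh : Continuous fun p : (ι → G) × (ι → G) => h p.1 p.2)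
    {C : ℝ} (hC : ∀ U V, ‖h U V‖ ≤ C) :
    Tendsto (fun n => ∫ U, h U ((↑(Λ n) : Set ι).mulIndicator U) ∂μ) atTop
      (𝓝 (∫ U, h U (Δ.mulIndicator U) ∂μ)) := by
  refine tendsto_integral_of_dominated_convergence (fun _ => C) (fun n => ?_) (integrable_const C)
    (fun n => ae_of_all _ fun U => hC _ _) (ae_of_all _ fun U => ?_)
  · exact (hh.comp
      (continuous_id.prodMk (continuous_config_mulIndicator _))).aestronglyMeasurable
  · exact (hh.tendsto _).comp
      (tendsto_const_nhds.prodMk_nhds (tendsto_config_mulIndicator hΛ hev U))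

end Truncation

/-! ### `L²` bookkeeping -/

section LTwo

variable {Ω : Type*} [MeasurableSpace Ω]

/-- From an `L²`-seminorm bound to a bound on `∫ ‖f‖²`. [folklore] -/
theorem integral_norm_sq_le_of_eLpNorm_le {μ : Measure Ω} {f : Ω → ℂ} (hf : MemLp f 2 μ)
    {δ : ℝ} (hδ : 0 ≤ δ) (h : eLpNorm f 2 μ ≤ ENNReal.ofReal δ) :
    ∫ x, ‖f x‖ ^ 2 ∂μ ≤ δ ^ 2 := by
  rw [hf.eLpNorm_eq_integral_rpow_norm two_ne_zero ENNReal.ofNat_ne_top,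
    ENNReal.ofReal_le_ofReal_iff hδ] at h
  simp only [ENNReal.toReal_ofNat, Real.rpow_two] at h
  have hI : 0 ≤ ∫ x, ‖f x‖ ^ 2 ∂μ := integral_nonneg fun x => by positivity
  rwa [Real.rpow_inv_le_iff_of_pos hI hδ two_pos, Real.rpow_two] at h

/-- The parallelogram-type bound `‖a - c‖² ≤ 2‖a - b‖² + 2‖b - c‖²`. [folklore] -/
theorem norm_sub_sq_le_two_mul (a b c : ℂ) :
    ‖a - c‖ ^ 2 ≤ 2 * ‖a - b‖ ^ 2 + 2 * ‖b - c‖ ^ 2 := by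
  nlinarith [norm_sub_le_norm_sub_add_norm_sub a b c, norm_nonneg (a - c), norm_nonneg (a - b),
    norm_nonneg (b - c), sq_nonneg (‖a - b‖ - ‖b - c‖)]

/-- Bounded measurable differences are square integrable against a finite measure. [folklore] -/
theorem integrable_norm_sub_sq (μ : Measure Ω) [IsFiniteMeasure μ] {φ ψ : Ω → ℂ}
    (hφ : Measurable φ) (hψ : Measurable ψ) {A B : ℝ} (hA : ∀ x, ‖φ x‖ ≤ A) (hB : ∀ x, ‖ψ x‖ ≤ B) :
    Integrable (fun x => ‖φ x - ψ x‖ ^ 2) μ := by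
  refine Integrable.of_bound ((hφ.sub hψ).norm.pow_const 2).aestronglyMeasurable ((A + B) ^ 2)
    (ae_of_all _ fun x => ?_)
  rw [norm_pow, norm_norm]
  exact pow_le_pow_left₀ (norm_nonneg _) ((norm_sub_le _ _).trans (add_le_add (hA x) (hB x))) 2

end LTwo

/-! ### The two side conditions for second countable compact groups -/

section Main

variable (G : Type) [Group G] [TopologicalSpace G] [IsTopologicalGroup G] [MeasurableSpace G]
  [BorelSpace G] [SecondCountableTopology G]

/-- **Density of continuous positive-time cylinder observables** (`CylinderApprox`) for every
finite measure on the gauge fields over a second countable compact group: a bounded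
`𝓔₊`-measurable `F` depends only on the positive-time links, so `F = F ∘ P` for the truncation
`P` to `posTimeEdges`; approximate `F` in `L²(P_* μ)` by a bounded continuous `g` (finite Borel
measures on the metrisable configuration space are weakly regular), pull back along `P`, and
replace `g ∘ P` by `g ∘ P_n` for a large finite truncation `P_n` (dominated convergence).
[cite: GlimmJaffe1987, §6.1] -/
theorem cylinderApprox_of_secondCountable (μ : Measure (LGConfig 4 G)) [IsFiniteMeasure μ] :
    CylinderApprox μ := by
  intro F hF ε hε
  obtain ⟨hFm, C, hC⟩ := hF
  set Δ := (posTimeEdges : Set (Literature.MathematicalPhysics.QuantumLattice.ZdEdge 4)) with hΔ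
  -- `F` depends only on the positive-time links
  have hdep : DependsOn F Δ := dependsOn_of_measurable_cylinderEvents' hFm
  have hFP : ∀ U, F (Δ.mulIndicator U) = F U := fun U => apply_mulIndicator_of_dependsOn hdep U
  have hFmeas : Measurable F := hFm.mono cylinderEvents_le_pi le_rfl
  have hPcont : Continuous (Δ.mulIndicator : LGConfig 4 G → LGConfig 4 G) :=
    continuous_config_mulIndicator Δ
  -- push forward along the truncation and approximate there
  set ν : Measure (LGConfig 4 G) := μ.map Δ.mulIndicator with hν
  have hFν : MemLp F 2 ν := MemLp.of_bound hFmeas.aestronglyMeasurable C (ae_of_all _ hC)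
  have hδ : ENNReal.ofReal (√ε / 2) ≠ 0 := (ENNReal.ofReal_pos.2 (by positivity)).ne'
  obtain ⟨g, hg, g_mem⟩ := hFν.exists_boundedContinuous_eLpNorm_sub_le ENNReal.ofNat_ne_top hδ
  have h1 : ∫ U, ‖F U - g U‖ ^ 2 ∂ν ≤ ε / 4 := by
    have := integral_norm_sq_le_of_eLpNorm_le (hFν.sub g_mem) (by positivity) hg
    simp only [Pi.sub_apply] at this
    refine this.trans_eq ?_
    rw [div_pow, Real.sq_sqrt hε.le]
    norm_num
  have h2 : ∫ U, ‖F U - g (Δ.mulIndicator U)‖ ^ 2 ∂μ ≤ ε / 4 := by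
    have hint : ∫ U, ‖F U - g U‖ ^ 2 ∂ν =
        ∫ U, ‖F (Δ.mulIndicator U) - g (Δ.mulIndicator U)‖ ^ 2 ∂μ :=
      integral_map hPcont.measurable.aemeasurable
        ((hFmeas.sub g.continuous.measurable).norm.pow_const 2).aestronglyMeasurable
    simp_rw [hFP] at hint
    exact hint ▸ h1
  -- exhaust the positive-time links by finite sets and pass to a finite truncation
  obtain ⟨Λ, hΛ, hev⟩ := exists_finset_seq_exhaust Δ
  have h3 : Tendsto
      (fun n => ∫ U, ‖g (Δ.mulIndicator U) - g ((↑(Λ n) : Set _).mulIndicator U)‖ ^ 2 ∂μ)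
      atTop (𝓝 0) := by
    have := tendsto_integral_mulIndicator hΛ hev μ
      (h := fun U V => ‖g (Δ.mulIndicator U) - g V‖ ^ 2)
      (((g.continuous.comp (hPcont.comp continuous_fst)).sub
        (g.continuous.comp continuous_snd)).norm.pow 2) (C := (‖g‖ + ‖g‖) ^ 2) fun U V => by
        rw [norm_pow, norm_norm]
        exact pow_le_pow_left₀ (norm_nonneg _)
          ((norm_sub_le _ _).trans (add_le_add (g.norm_coe_le_norm _) (g.norm_coe_le_norm _))) 2
    simpa using this
  obtain ⟨n, hn⟩ := (h3.eventually (ge_mem_nhds (by positivity : (0 : ℝ) < ε / 4))).exists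
  refine ⟨fun U => g ((↑(Λ n) : Set _).mulIndicator U), Λ n, hΛ n, ?_,
    g.continuous.comp (continuous_config_mulIndicator _), ?_,
    ⟨‖g‖, fun U => g.norm_coe_le_norm _⟩, ?_⟩
  · unfold IsCylinder
    exact dependsOn_comp_mulIndicator _ _
  · exact g.continuous.measurable.comp (measurable_config_mulIndicator (hΛ n))
  · have hgP : Measurable fun U => g (Δ.mulIndicator U) :=
      g.continuous.measurable.comp hPcont.measurable
    have hgPn : Measurable fun U => g ((↑(Λ n) : Set _).mulIndicator U) :=
      g.continuous.measurable.comp (continuous_config_mulIndicator _).measurable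
    calc ∫ U, ‖F U - g ((↑(Λ n) : Set _).mulIndicator U)‖ ^ 2 ∂μ
        ≤ ∫ U, (2 * ‖F U - g (Δ.mulIndicator U)‖ ^ 2 +
            2 * ‖g (Δ.mulIndicator U) - g ((↑(Λ n) : Set _).mulIndicator U)‖ ^ 2) ∂μ := by
          refine integral_mono
            (integrable_norm_sub_sq μ hFmeas hgPn hC fun U => g.norm_coe_le_norm _)
            (((integrable_norm_sub_sq μ hFmeas hgP hC
                fun U => g.norm_coe_le_norm _).const_mul 2).add
              ((integrable_norm_sub_sq μ hgP hgPn (fun U => g.norm_coe_le_norm _)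
                fun U => g.norm_coe_le_norm _).const_mul 2))
            fun U => norm_sub_sq_le_two_mul _ _ _
      _ = 2 * ∫ U, ‖F U - g (Δ.mulIndicator U)‖ ^ 2 ∂μ +
            2 * ∫ U, ‖g (Δ.mulIndicator U) - g ((↑(Λ n) : Set _).mulIndicator U)‖ ^ 2 ∂μ := by
          rw [integral_add ((integrable_norm_sub_sq μ hFmeas hgP hC
              fun U => g.norm_coe_le_norm _).const_mul 2)
            ((integrable_norm_sub_sq μ hgP hgPn (fun U => g.norm_coe_le_norm _)
              fun U => g.norm_coe_le_norm _).const_mul 2), integral_const_mul, integral_const_mul]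
      _ ≤ 2 * (ε / 4) + 2 * (ε / 4) := by gcongr
      _ = ε := by ring

/-- **Bounded continuous cylinder observables determine probability measures** (`CylinderExt`)
on the gauge fields over a second countable compact group: for a bounded continuous `f` the
cylinder observables `f ∘ P_n` (finite truncations `P_n`) converge boundedly to `f`, so two
measures agreeing on continuous cylinder observables agree on all bounded continuous `f`, hence
are equal (finite Borel measures on a metrisable space). [cite: GlimmJaffe1987, §6.1] -/
theorem cylinderExt_of_secondCountable : CylinderExt G := by
  intro μ ν _ _ h
  refine ext_of_forall_integral_eq_of_IsFiniteMeasure fun f => ?_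
  obtain ⟨Λ, -, hev⟩ := exists_finset_seq_exhaust
    (Set.univ : Set (Literature.MathematicalPhysics.QuantumLattice.ZdEdge 4))
  have hlim : ∀ (ρ : Measure (LGConfig 4 G)) [IsFiniteMeasure ρ],
      Tendsto (fun n => ∫ U, f ((↑(Λ n) : Set _).mulIndicator U) ∂ρ) atTop
        (𝓝 (∫ U, f U ∂ρ)) := by
    intro ρ _
    have := tendsto_integral_mulIndicator (fun n => Set.subset_univ _) hev ρ
      (h := fun _ V => f V)
      (f.continuous.comp continuous_snd) (C := ‖f‖) fun _ V => f.norm_coe_le_norm V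
    simpa using this
  have heq : (fun n => ∫ U, f ((↑(Λ n) : Set _).mulIndicator U) ∂μ) =
      fun n => ∫ U, f ((↑(Λ n) : Set _).mulIndicator U) ∂ν :=
    funext fun n => h _ (Λ n) (dependsOn_comp_mulIndicator _ _)
      (f.continuous.comp (continuous_config_mulIndicator _))
      ⟨‖f‖, fun U => by
        simpa [Real.norm_eq_abs] using f.norm_coe_le_norm ((↑(Λ n) : Set _).mulIndicator U)⟩
  exact tendsto_nhds_unique (hlim μ) (heq ▸ hlim ν)

end Main

/-- **Stub `stub_cylinderApprox`** of the line `spectral-requantisation-dock`: for a compact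
simple Lie group `G` (second countable through its faithful matrix representation) every
probability measure on the `ℤ⁴` gauge fields has the cylinder approximation property
`CylinderApprox`, and bounded continuous real cylinder observables separate probability
measures (`CylinderExt`). [cite: GlimmJaffe1987, §6.1] -/
theorem stub_cylinderApprox :
    ∀ (G : Type) [Group G] [TopologicalSpace G] [IsTopologicalGroup G] [CompactSpace G]
      [MeasurableSpace G] [BorelSpace G], IsCompactSimpleLieGroup G →
        (∀ (μ : Measure (LGConfig 4 G)) [IsProbabilityMeasure μ], CylinderApprox μ) ∧
          CylinderExt G := by
  intro G _ _ _ _ _ _ hG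
  obtain ⟨r⟩ := hG.2
  haveI : SecondCountableTopology G :=
    (r.continuous.isClosedEmbedding r.injective).isEmbedding.secondCountableTopology
  exact ⟨fun μ _ => cylinderApprox_of_secondCountable G μ, cylinderExt_of_secondCountable G⟩

end Summit.QuantumFields.YangMills.Theorems.ClusteringToYangMills

end
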